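import Literature.Geometry.Kaehler.ComplexTorusPicardNumberThirdGap
import Literature.Geometry.Kaehler.ComplexTorusHodgeClassesImaginaryPeriod
import Literature.Geometry.Kaehler.ComplexTorusSiegelRiemannForm
import HarnessLib

/-!
# `R_2 = {1, 2, 3, 4}`: an abelian surface of Picard number one, and the boxes `R_{g,2}`, `R_{g,3}` made explicit

[cite: HulekLaface2019PicardNumbersAV, §1]: "By the above we know that `1 ≤ ρ ≤ g²`.  For `g = 1` we
clearly have `ρ = 1`.  For `g = 2`, by work of […] all values `1 ≤ ρ ≤ 4` occur […] it is not hard to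
show that `R_3 = {1, …, 6, 9}`", and [cite: HulekLaface2019PicardNumbersAV, §6.2 Prop. 6.4]: "a very
general (principally polarized) abelian variety of dimension `g` has Picard number `1`".

The sets `R_g = picardNumbers g` of `ComplexTorusPicardNumberAsymptoticDensity.lean` were determined
there and in `ComplexTorusPicardNumberThirdGap.lean` up to the members requiring abelian varieties that
are not products of elliptic curves: `1 ∈ R_2`, `1, 2 ∈ R_3`, and the box members `(g−2)² + 1`,
`(g−3)² + 1`, `(g−3)² + 2` of Thm. 7.4.  Here an EXPLICIT abelian surface of Picard number one closes
all of these but `1 ∈ R_3` / `(g−3)² + 1`: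

* §1 **`ℂ^n/(Zℤ^n ⊕ ℤ^n)` with `Z = ᵗZ`, `Im Z ≻ 0` is an abelian variety** — the Siegel torus of the
  tree's normal form `periodIsoOfNormalForm Z` (`isAbelianVariety_periodIsoOfNormalForm_of_posDef`, from
  `isAbelianVariety_siegel_typeD` of `ComplexTorusSiegelRiemannForm.lean` by exchanging the two lattice
  blocks). [cite: Lange2023AbelianVarietiesComplex, §3.1 Prop. 3.1.1 / Lange–Birkenhake §8.1 Prop. 8.1.1]
* §2 **the abelian surface `X_{p,q} = ℂ²/(iYℤ² ⊕ ℤ²)`, `Y = (√p 1; 1 √q)` (`p ≠ q` primes) has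
  `ρ = 1`** (`Y` symmetric positive definite; `ρ = 1` is the `ρ`-column entry of Lange's Exercise
  5.1.5 (3)(b), `finrank_neronSeveriGroup_iPeriod_sqrt_one_one_sqrt` of
  `ComplexTorusHodgeClassesImaginaryPeriod.lean`): `one_mem_picardNumbers_two`, hence
  **`picardNumbers_two : R_2 = {1, 2, 3, 4}`** as printed, `two_mem_picardNumbers_three` (`E × X_{p,q}`)
  and `{2, …, 6, 9} ⊆ R_3 ⊆ {1, …, 6, 9}`.
* §3 the boxes of Thm. 7.4 made explicit: for `g ≥ 8`,
  `R_g ∩ ((g−2)², (g−2)² + 4] = {(g−2)² + 1, (g−2)² + 2, (g−2)² + 3, (g−2)² + 4}`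
  (`picardNumbers_inter_Ioc_secondBox_eq`); for `g ≥ 12`,
  `(g−3)² + {2, …, 6, 9} ⊆ R_g ∩ ((g−3)², (g−3)² + 9] ⊆ (g−3)² + {1, …, 6, 9}`; and
  `sq_add_one_mem_picardNumbers` (`t² + 1 ∈ R_{t+2}` — the member `(g−2)² + 1`).

No definition, no named fact (net debt 0).  Not covered: `1 ∈ R_g` for `g ≥ 3` (Prop. 6.4, a very
general abelian variety; an explicit threefold of Picard number one would need the analogue of
Exercise 5.1.5 (3) in dimension `3`).

## References

* [HulekLaface2019PicardNumbersAV] K. Hulek, R. Laface, *On the Picard numbers of abelian varieties*,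
  Ann. Sc. Norm. Super. Pisa Cl. Sci. (5) XIX (2019) 1199–1224 (arXiv:1703.05882), §1, §6.2 Prop. 6.4,
  §7.2 Thm. 7.4.
* [Lange2023AbelianVarietiesComplex] H. Lange, *Abelian Varieties over the Complex Numbers*, Grundlehren
  Text Edition, Springer (2023), §3.1 Prop. 3.1.1 (Siegel space, Riemann relations), §5.1.5 Exercise (3).
* [LangeBirkenhake1992] H. Lange, Ch. Birkenhake, *Complex Abelian Varieties*, Springer (1992), §8.1
  Prop. 8.1.1.
-/

open Module Matrix Function
open Complex (I ofReal)

namespace Literature.Geometry.Kaehler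

namespace ComplexTorus

/-! ## §1 The Siegel torus of the normal form `(Z, 1)` is an abelian variety -/

section Siegel

variable {n : ℕ}

/-- **`ℂ^n/(Zℤ^n ⊕ ℤ^n)` is an abelian variety for `Z = ᵗZ` with `Im Z` positive definite** (Riemann's
relations for the period matrix `(Z, 1_n)`; the polarization is `H_Z = (Im Z)⁻¹`).  Obtained from the
type-`D` Siegel torus `ℂ^n/(Dℤ^n ⊕ Ωℤ^n)` of `ComplexTorusSiegelRiemannForm.lean` with `D = 1`, `Ω = Z`
by exchanging the two blocks of the lattice basis (an isomorphism of complex tori).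
[cite: Lange2023AbelianVarietiesComplex, §3.1 Prop. 3.1.1] [cite: LangeBirkenhake1992, §8.1 Prop. 8.1.1] -/
theorem isAbelianVariety_periodIsoOfNormalForm_of_posDef (Z : Matrix (Fin n) (Fin n) ℂ)
    (hZ : (Z.map Complex.im).det ≠ 0) (hsymm : ∀ i j, Z i j = Z j i)
    (hpos : (Matrix.of fun i j ↦ (Z i j).im).PosDef) : IsAbelianVariety (periodIsoOfNormalForm Z hZ) := by
  -- the block-swapped period isomorphism `Ψ v = Φ (v ∘ swap)`, of type `D = 1`
  let e : Fin n ⊕ Fin n ≃ Fin n ⊕ Fin n := Equiv.sumComm (Fin n) (Fin n)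
  let Ψ : (Fin n ⊕ Fin n → ℝ) ≃L[ℝ] (Fin n → ℂ) :=
    (LinearEquiv.funCongrLeft ℝ ℝ e).toContinuousLinearEquiv.trans (periodIsoOfNormalForm Z hZ)
  have hΨapply : ∀ v, Ψ v = periodIsoOfNormalForm Z hZ (fun c ↦ v (e c)) := fun v ↦ rfl
  have hΨ : ∀ v i, Ψ v i = (((fun _ ↦ 1 : Fin n → ℕ) i : ℕ) : ℂ) * (v (Sum.inl i) : ℂ) +
      ∑ j, Z i j * (v (Sum.inr j) : ℂ) := by
    intro v i
    rw [hΨapply, periodIsoOfNormalForm_apply_eq_mulVec, Matrix.fromCols_mulVec, Pi.add_apply,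
      Matrix.one_mulVec]
    simp only [Matrix.mulVec, dotProduct, Function.comp_apply, e, Equiv.sumComm_apply, Sum.swap_inl,
      Sum.swap_inr, Nat.cast_one, one_mul]
    ring
  have hA : IsAbelianVariety Ψ := isAbelianVariety_siegel_typeD Z (fun _ ↦ 1) Ψ hΨ hsymm hpos
  -- `Φ ≅ Ψ` by reindexing the lattice basis
  have hiso : IsIsomorphic (periodIsoOfNormalForm Z hZ) Ψ :=
    isIsomorphic_of_reindex (periodIsoOfNormalForm Z hZ) Ψ e (ContinuousLinearMap.id ℂ (Fin n → ℂ))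
      fun x ↦ by
        rw [hΨapply, ContinuousLinearMap.id_apply]
        congr 1
        funext c
        simp only [Equiv.symm_apply_apply]
  exact (hiso.isIsogenous.isAbelianVariety_iff).2 hA

end Siegel

/-! ## §2 An abelian surface of Picard number one; `R_2 = {1, 2, 3, 4}` -/

section Surface

/-- `Y = (√p 1; 1 √q)` is positive definite for `p, q ≥ 2` (`√p, √q > 1`:
`ᵗx Y x = (x₀ + x₁)² + (√p − 1)x₀² + (√q − 1)x₁²`). [cite: Lange2023AbelianVarietiesComplex, §5.1.5 Exercise (3)(b)] -/
theorem posDef_sqrt_one_one_sqrt {p q : ℕ} (hp : 2 ≤ p) (hq : 2 ≤ q) :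
    (Matrix.of fun i j ↦ ((I • (!![Real.sqrt p, 1; 1, Real.sqrt q] : Matrix (Fin 2) (Fin 2) ℝ).map ofReal) i j).im).PosDef := by
  have hY : (Matrix.of fun i j ↦ ((I • (!![Real.sqrt p, 1; 1, Real.sqrt q] : Matrix (Fin 2) (Fin 2) ℝ).map ofReal) i j).im) =
      !![Real.sqrt p, 1; 1, Real.sqrt q] := by
    ext i j
    fin_cases i <;> fin_cases j <;> simp
  rw [hY]
  have hp1 : 1 < Real.sqrt p := by
    rw [show (1 : ℝ) = Real.sqrt 1 from Real.sqrt_one.symm]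
    exact Real.sqrt_lt_sqrt zero_le_one (by exact_mod_cast hp)
  have hq1 : 1 < Real.sqrt q := by
    rw [show (1 : ℝ) = Real.sqrt 1 from Real.sqrt_one.symm]
    exact Real.sqrt_lt_sqrt zero_le_one (by exact_mod_cast hq)
  refine Matrix.posDef_iff_dotProduct_mulVec.2 ⟨?_, fun x hx ↦ ?_⟩
  · refine Matrix.IsHermitian.ext fun i j ↦ ?_
    fin_cases i <;> fin_cases j <;> simp
  · have hx' : x 0 ≠ 0 ∨ x 1 ≠ 0 := by
      by_contra h
      push Not at h
      exact hx (funext fun i ↦ by fin_cases i <;> simp [h.1, h.2])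
    simp only [star_trivial, Matrix.mulVec, dotProduct, Fin.sum_univ_two, Matrix.of_apply, Matrix.cons_val',
      Matrix.cons_val_zero, Matrix.cons_val_one, Matrix.empty_val', Matrix.cons_val_fin_one]
    rcases hx' with h0 | h1
    · have h0' : 0 < x 0 * x 0 := mul_self_pos.2 h0
      nlinarith [mul_self_nonneg (x 0 + x 1), mul_self_nonneg (x 1), mul_pos (sub_pos.2 hp1) h0']
    · have h1' : 0 < x 1 * x 1 := mul_self_pos.2 h1
      nlinarith [mul_self_nonneg (x 0 + x 1), mul_self_nonneg (x 0), mul_pos (sub_pos.2 hq1) h1']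

/-- **The surface `X_{p,q} = ℂ²/(iYℤ² ⊕ ℤ²)`, `Y = (√p 1; 1 √q)`, is an abelian surface** (`iY` lies in
the Siegel upper half space: `Y = ᵗY ≻ 0`). [cite: Lange2023AbelianVarietiesComplex, §3.1 Prop. 3.1.1 and §5.1.5 Exercise (3)(b)] -/
theorem isAbelianVariety_iPeriod_sqrt_one_one_sqrt {p q : ℕ} (hp : p.Prime) (hq : q.Prime) (hpq : p ≠ q) :
    IsAbelianVariety (periodIsoOfNormalForm
      (I • (!![Real.sqrt p, 1; 1, Real.sqrt q] : Matrix (Fin 2) (Fin 2) ℝ).map ofReal)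
      (det_map_im_iMatrix_ne_zero (det_sqrt_one_one_sqrt_ne_zero hp hq hpq))) :=
  isAbelianVariety_periodIsoOfNormalForm_of_posDef _ _
    (fun i j ↦ by fin_cases i <;> fin_cases j <;> simp) (posDef_sqrt_one_one_sqrt hp.two_le hq.two_le)

/-- **`1 ∈ R_2`: there is an abelian surface of Picard number one** (`X_{2,3}`; Lange's table:
`dim_ℚ(√2, 1, 1, √3) = 3`, `det Y ∉ ℚ`, `ρ = 1`). [cite: HulekLaface2019PicardNumbersAV, §1 ("For `g = 2` […] all values `1 ≤ ρ ≤ 4` occur")] [cite: Lange2023AbelianVarietiesComplex, §5.1.5 Exercise (3)(b)] -/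
theorem one_mem_picardNumbers_two : 1 ∈ picardNumbers 2 := by
  have hA := isAbelianVariety_iPeriod_sqrt_one_one_sqrt Nat.prime_two Nat.prime_three (by norm_num)
  have h := hA.mem_picardNumbers
  rwa [finrank_neronSeveriGroup_iPeriod_sqrt_one_one_sqrt Nat.prime_two Nat.prime_three (by norm_num),
    Module.finrank_fin_fun] at h

/-- **`R_2 = {1, 2, 3, 4}`** ("For `g = 2` […] all values `1 ≤ ρ ≤ 4` occur": `X_{2,3}`, `E_1 × E_2`,
`E_θ²`, `E²` with `E, E_i` CM). [cite: HulekLaface2019PicardNumbersAV, §1] -/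
theorem picardNumbers_two : picardNumbers 2 = {1, 2, 3, 4} := by
  ext y
  constructor
  · intro hy
    have h := picardNumbers_subset_Icc (by norm_num : 1 ≤ 2) hy
    rw [Set.mem_Icc] at h
    simp only [Set.mem_insert_iff, Set.mem_singleton_iff]
    omega
  · simp only [Set.mem_insert_iff, Set.mem_singleton_iff]
    rintro (rfl | rfl | rfl | rfl)
    · exact one_mem_picardNumbers_two
    · simpa using choose_add_sum_sq_mem_picardNumbers (S := Fin 2) (fun _ ↦ 1) 0
    · exact three_mem_picardNumbers_two
    · exact four_mem_picardNumbers_two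

/-- **`t² + 1 ∈ R_{t+2}`** (`E^t × X_{2,3}` with `E = E_{i√r}` CM and `Hom(E, X_{2,3}) = 0`): the member
`(g−2)² + 1` of the box `R_{g,2}` in every dimension `g ≥ 2`. [cite: HulekLaface2019PicardNumbersAV, §7.2 (`R_{g,2} = (g−2)² + R_2`)] -/
theorem sq_add_one_mem_picardNumbers (t : ℕ) : t ^ 2 + 1 ∈ picardNumbers (t + 2) :=
  sq_add_mem_picardNumbers_of_mem one_mem_picardNumbers_two t

/-- **`2 ∈ R_3`** (`E × X_{2,3}`). [cite: HulekLaface2019PicardNumbersAV, §1 ("`R_3 = {1, …, 6, 9}`")] -/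
theorem two_mem_picardNumbers_three : 2 ∈ picardNumbers 3 := by
  simpa using sq_add_one_mem_picardNumbers 1

/-- **`{2, 3, 4, 5, 6, 9} ⊆ R_3 ⊆ {1, …, 6, 9}`** (all members of `R_3 = {1, …, 6, 9}` but `1`, which needs an
abelian threefold of Picard number one). [cite: HulekLaface2019PicardNumbersAV, §1 ("`R_3 = {1, …, 6, 9}`")] -/
theorem subset_picardNumbers_three_subset :
    ({2, 3, 4, 5, 6, 9} : Set ℕ) ⊆ picardNumbers 3 ∧ picardNumbers 3 ⊆ Set.Icc 1 6 ∪ {9} := by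
  refine ⟨fun y hy ↦ ?_, picardNumbers_three_subset⟩
  rcases hy with rfl | hy
  · exact two_mem_picardNumbers_three
  · exact subset_picardNumbers_three hy

end Surface

/-! ## §3 The boxes `R_{g,2}`, `R_{g,3}` made explicit -/

section Boxes

/-- **The box `R_{g,2}` is full: for `g ≥ 8`, `R_g ∩ ((g−2)², (g−2)² + 4] = {(g−2)² + 1, …, (g−2)² + 4}`**
(`= (g−2)² + R_2` with `R_2 = {1, 2, 3, 4}`). [cite: HulekLaface2019PicardNumbersAV, §7.2 Thm. 7.4 (the box `R_{g,2}`) with §1 (`R_2`)] -/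
theorem picardNumbers_inter_Ioc_secondBox_eq {g : ℕ} (hg : 8 ≤ g) :
    picardNumbers g ∩ Set.Ioc ((g - 2) ^ 2) ((g - 2) ^ 2 + 4) =
      {(g - 2) ^ 2 + 1, (g - 2) ^ 2 + 2, (g - 2) ^ 2 + 3, (g - 2) ^ 2 + 4} := by
  rw [picardNumbers_inter_Ioc_secondBox hg, picardNumbers_two]
  ext y
  simp only [Set.mem_image, Set.mem_insert_iff, Set.mem_singleton_iff]
  constructor
  · rintro ⟨x, hx, rfl⟩
    rcases hx with rfl | rfl | rfl | rfl <;> simp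
  · rintro (rfl | rfl | rfl | rfl)
    exacts [⟨1, Or.inl rfl, rfl⟩, ⟨2, Or.inr (Or.inl rfl), rfl⟩, ⟨3, Or.inr (Or.inr (Or.inl rfl)), rfl⟩,
      ⟨4, Or.inr (Or.inr (Or.inr rfl)), rfl⟩]

/-- **The box `R_{g,3}` for `g ≥ 12`: `(g−3)² + {2, …, 6, 9} ⊆ R_g ∩ ((g−3)², (g−3)² + 9] ⊆ (g−3)² + {1, …, 6, 9}`.**
[cite: HulekLaface2019PicardNumbersAV, §7.2 Thm. 7.4 (the box `R_{g,3}`) with §1 (`R_3`)] -/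
theorem picardNumbers_inter_Ioc_thirdBox_bounds {g : ℕ} (hg : 12 ≤ g) :
    (fun x ↦ (g - 3) ^ 2 + x) '' ({2, 3, 4, 5, 6, 9} : Set ℕ) ⊆
        picardNumbers g ∩ Set.Ioc ((g - 3) ^ 2) ((g - 3) ^ 2 + 9) ∧
      picardNumbers g ∩ Set.Ioc ((g - 3) ^ 2) ((g - 3) ^ 2 + 9) ⊆
        (fun x ↦ (g - 3) ^ 2 + x) '' (Set.Icc 1 6 ∪ {9}) := by
  rw [picardNumbers_inter_Ioc_thirdBox hg]
  exact ⟨Set.image_mono subset_picardNumbers_three_subset.1,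
    Set.image_mono subset_picardNumbers_three_subset.2⟩

end Boxes

end ComplexTorus

end Literature.Geometry.Kaehler
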